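import Mathlib
import HarnessLib
import Summits.ResolutionOfSingularities.ResolutionOfSingularities.Theorems.WildQuotientsWildQuotientResolutionS1aPrincipalCentre
import Summits.ResolutionOfSingularities.ResolutionOfSingularities.Theorems.WildQuotientsWildQuotientResolutionS1aOneShotKillChartV5

/-!
# S1a — V5 KILL-CENTRE CHARTS (boundary `ε`, shift `δ`, triangular hits) ARE PRINCIPAL-CENTRE CHARTS

[OURS · L1 W4.5c · lead-1 g7; plan-1 ASSIGNMENT v10.5 (3): `isPrincipalCentreChart_of_killDataV5`] — NOT statements of the manuscript;
counted 0; AI-level work, weaker than expert review. Crux stmt-ResolutionOfSingularities-17941, line `s1a-logminvertex` v6.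

* `NodeAtlas.IsKillCentreChartV5 p ρ g₀ 𝒦 d O` — `IsCentreChart` data + the hypotheses of
  `OneShotKill.augmentationIdeal_sigmaChart_eq_span_triangular` (`ChartOneShotKillV5`): old boundary `ε`, shift `δ`, gr-shift data,
  radical clause, bottom-or-triangular-hit per index. (`ε = 1, δ = 0` with linear hits is the depth form v1.)
* **`isPrincipalCentreChart_of_isKillCentreChartV5`** — the producer: every V5 kill-centre chart is a principal-centre chart, hence feeds
  the whole (T2e)/(two-phase) chain (`…S1aPrincipalCentreGood`, `…S1aKillOrAux`).
-/

set_option linter.dupNamespace false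

noncomputable section

open CategoryTheory AlgebraicGeometry TopologicalSpace
open Literature.AlgebraicGeometry.Resolution Literature.AlgebraicGeometry.RelativeSpec
open Summit.ResolutionOfSingularities.ResolutionOfSingularities.Theorems.WildQuotientResolution.S1
open Summit.ResolutionOfSingularities.ResolutionOfSingularities.Theorems.WildQuotientResolution.S1.ProducerStep
open Summit.ResolutionOfSingularities.ResolutionOfSingularities.Theorems.WildQuotientResolution.S1.CoarseChart

namespace Summit.ResolutionOfSingularities.ResolutionOfSingularities.Theorems.WildQuotientResolution.S1.NodeAtlas

universe u

section Centre

variable (p : ℕ) {V Y : Scheme.{u}} {q : V ⟶ Y} {G : Type*} [Group G] (ρ : ActionOver q G) (g₀ : G)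

/-- **V5 KILL-centre chart**: `IsCentreChart` data plus the one-shot kill in its V5 form — old boundary `ε`, shift `δ`, gr-shift
`σ y − y ∈ ε K δ`, depth `σ f_i − f_i ∈ ε K (w_i + δ)`, radical `ε f_i^N ∈ I_σ`, and every index BOTTOM or TRIANGULARLY HIT.
[OURS · L1 W4.5c] -/
def IsKillCentreChartV5 (𝒦 : ReesFiltration V) (d : ℕ) (O : ρ.StableAffineOpens) : Prop :=
  ∃ (hO : IsAffineOpen O.1) (m : ℕ) (r : Fin m → ℕ) (B : Type u) (_ : CommRing B)
    (𝒜 : (Π j : Fin m, ZMod (r j)) → AddSubgroup B) (_ : GradedRing 𝒜) (σ : B ≃+* B)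
    (e : Γ(V, O.1) ≃+* ↥(𝒜 0)),
    IsTameNode p B 𝒜 σ ∧
    (∀ t : Γ(V, O.1),
      ((e ((ρ.aut g₀⁻¹).hom.appLE O.1 O.1 (O.2.1 g₀⁻¹).ge t) : ↥(𝒜 0)) : B) = σ ((e t : ↥(𝒜 0)) : B)) ∧
    ∃ (c : ℕ) (f : Fin c → B) (δw : Fin c → Π j : Fin m, ZMod (r j)) (w : Fin c → ℕ),
      0 < c ∧ (∀ i, f i ∈ 𝒜 (δw i)) ∧ (∀ i, 0 < w i) ∧
      RingTheory.Sequence.IsRegular B (List.ofFn f) ∧ IsRegularRing (B ⧸ Ideal.span (Set.range f)) ∧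
      ∃ (_ : ∀ n : ℕ, ((weightedFiltration f w).ideal n).map (σ : B →+* B) ≤ (weightedFiltration f w).ideal n),
      (∀ n : ℕ, (𝒦.filtration ⟨O.1, hO⟩).ideal n =
        ((CoarseChart.traceFiltration 𝒜 f w).ideal n).comap (e : Γ(V, O.1) →+* ↥(𝒜 0))) ∧
      CoarseChart.VeroneseNormalised 𝒜 f w d ∧
      ∃ (ε : B) (δ : ℕ),
        (∀ y : B, ∃ t ∈ (weightedFiltration f w).ideal δ, σ y - y = ε * t) ∧
        (∀ i, ∃ t ∈ (weightedFiltration f w).ideal (w i + δ), σ (f i) - f i = ε * t) ∧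
        (∀ i, ∃ N : ℕ, ε * f i ^ N ∈ augmentationIdeal σ) ∧
        (∀ i, (w i = δ ∧ ε * f i ∈ augmentationIdeal σ) ∨ ∃ (h : Fin c) (u : B) (k : ℕ), k * w i = w h + δ ∧
          IsUnit (Ideal.Quotient.mk ((weightedFiltration f w).ideal 1) u) ∧
          ∃ t ∈ OneShotKill.triangularError f w δ h i, σ (f h) - f h - ε * u * f i ^ k = ε * t)

variable {p ρ g₀}

/-- **THE V5 PRODUCER**: a V5 kill-centre chart is a principal-centre chart (`augmentationIdeal_sigmaChart_eq_span_triangular` on every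
chart ring). [OURS · L1 W4.5c] -/
theorem isPrincipalCentreChart_of_isKillCentreChartV5 {𝒦 : ReesFiltration V} {d : ℕ} {O : ρ.StableAffineOpens}
    (h : IsKillCentreChartV5 p ρ g₀ 𝒦 d O) : IsPrincipalCentreChart p ρ g₀ 𝒦 d O := by
  obtain ⟨hO, m, r, B, _, 𝒜, _, σ, e, hnode, hσ, c, f, δw, w, hc, hf, hw, hK1, hK1', hσJ, h𝒦, hver, ε, δ, h1, hdepth, hrad, hrel⟩ := h
  refine ⟨hO, m, r, B, inferInstance, 𝒜, inferInstance, σ, e, hnode, hσ, c, f, δw, w, hc, hf, hw, hK1, hK1', hσJ, h𝒦, hver, ?_⟩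
  intro hp hσp d' b hb hσb hd'
  exact ⟨⟨_, OneShotKill.augmentationIdeal_sigmaChart_eq_span_triangular 𝒜 f w d' b hb σ hσJ hp hσp hσb ε δ hd' h1 hdepth hrad hrel⟩⟩

end Centre

end Summit.ResolutionOfSingularities.ResolutionOfSingularities.Theorems.WildQuotientResolution.S1.NodeAtlas

end
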